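import Summits.BirchSwinnertonDyer.BirchSwinnertonDyer.Theorems.ResidualThetaTransportAtTwoThetaLayerLambdaCongruenceAtTwoCuspSpanFourInvariance
import Mathlib.NumberTheory.LSeries.PrimesInAP
import Mathlib.NumberTheory.LegendreSymbol.QuadraticReciprocity
import HarnessLib

/-!
# Route `ResidualThetaTransportAtTwo`, cruxes Kan⁺ (stmt-BirchSwinnertonDyer-20688) / node 27436 / 21437: the **SIGN COMPANION**
# of the `B₁`-character — `E(u, 4^m/u)` at EVERY odd level from a Dirichlet prime `q ≡ 5 (mod 8)`, hence
# **`F(−u) = F(u)` and `F(1/u) = F(u)` at every odd PRIME level**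

Cell `bsd-wall`, width seat `bsd-wall-rtt-p3-w5` g2 (2026-08-28), lane «two-fold `B₁`-products at every odd level». THEOREMS ONLY
(no `def`, no `sorry`); `--supports stmt-BirchSwinnertonDyer-20688`. BSD is not proved by this; the node `CuspSpanEvenAtTwo N`
stays a hypothesis at every level not covered by a certificate.

SETTING (as in `…CuspSpanGenerationB1`, `…CuspSpanFourInvariance`). `χ : Γ₀(N) → ZMod 2` additive (`hadd`), killing the
elements of trace `0, ±1, ±2` (`hsmall`) and the elements whose lower-right entry is `±4^k`, `k ≥ 1` (`hkill`). On `B₁ = {b = −1}`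
`χ` is a function `F(d mod N)` (`chi_eq_of_apply_zero_one_eq_neg_one`). The lead's 4-INVARIANCE (`…CuspSpanFourInvariance` Thm 2)
multiplies two `b = −1` elements to an element with lower-right entry EXACTLY `−4^k` (`q ∣ 4^k − 1`). THIS FILE uses the other
sign: a product with lower-right entry EXACTLY `+4^m`, which needs a modulus `q ∣ 4^m + 1`.

THEOREM 1 (`dvd_four_pow_add_one_of_mod_eight_eq_five`). A prime `q ≡ 5 (mod 8)` divides `4^{(q−1)/4} + 1`: `2` is a
non-residue mod `q` (second supplement), so `2^{(q−1)/2} ≡ −1` (Euler's criterion) and `(q−1)/2 = 2·((q−1)/4)`.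

THEOREM 2 (`exists_chi_eq_of_b_neg_one_of_mul_d_eq_four_pow`, ANY odd level `N`). For every `b = −1` element `β` there is
`m ≥ 1` with `E(d(β), 4^m/d(β))`: `χ β = χ β'` for every `b = −1` element `β'` with `d(β) d(β') ≡ 4^m (mod N)`. PROOF. Dirichlet
(Mathlib `Nat.forall_exists_prime_gt_and_modEq`): a prime `q ≡ 5 (mod 8)`, `q ≡ d(β) (mod N)`; `m := (q−1)/4`, `4^m + 1 = q m₀`
(Thm 1). With `α₁ q + κ₁ N = 1` put `β₁ := (α₁, −1; Nκ₁, q)`, `δ₂ := m₀ − α₁` (so `q δ₂ = 4^m + κ₁N`, prime to `N`) and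
`β₂ := (α₂, −1; Nκ₂, δ₂)`: the product `β₁β₂` has lower-right entry `−Nκ₁ + qδ₂ = +4^m`, so `χ(β₁β₂) = 0`, `χ β₁ = χ β₂`, and
`d(β₁) ≡ d(β)`, `d(β) d(β₂) ≡ 4^m`.

THEOREM 3 (`chi_eq_of_b_neg_one_of_d_eq_neg_of_four`, any odd level GIVEN 4-invariance `E(4u, u)` as a hypothesis;
`chi_eq_of_b_neg_one_of_d_eq_neg`, unconditionally at every odd PRIME level by the lead's `chi_eq_of_b_neg_one_of_d_eq_four_mul`).
**`F(−u) = F(u)`**: `u ∼ 4^m/u` (Thm 2) `∼ −u/4^m` (`S`-companion, `…FourInvariance` Thm 1) `∼ −u` (4-invariance, `m` times).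
COROLLARY (`chi_eq_of_b_neg_one_of_mul_d_eq_one[_of_four]`). **`F(1/u) = F(u)`** (`1/u = −(−1/u)`). `K/E` forms for the certificate
calculus of `…CuspSpanKECalculus`: `E_of_eq_neg`, `E_of_mul_eq_one`, `K_of_K_neg`, `K_of_K_inv` (prime level).

CONSEQUENCE for line `birth`: at an odd prime level the `B₁`-character is constant on the orbits of the group generated by
`u ↦ 4u`, `u ↦ −u`, `u ↦ 1/u` (the lead's orbit certificates used `u ↦ 4u`, `u ↦ −1/u` only), and the functional criterion
«Theorem C(p)» of `…CuspSpanFunctional` may assume `F(−u) = F(u)` in addition. At a composite odd level Thm 2 holds as stated and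
Thm 3 holds as soon as 4-invariance does (companion file `…CuspSpanFourInvarianceOdd`).

References: P. G. L. Dirichlet (1837) / Mathlib `PrimesInAP`; Euler's criterion and the second supplement / Mathlib
`ZMod.euler_criterion`, `ZMod.exists_sq_eq_two_iff`; H. Rademacher, Abh. Math. Sem. Hamburg 7 (1929) §1 [Rademacher1929];
A. W. Knapp, *Elliptic curves* (1992) Prop. 11.1 [Knapp1993]; R. Pollack, Duke Math. J. 118 (2003) Conj. 6.3 [Pollack2003].
-/

set_option autoImplicit false
set_option linter.dupNamespace false

open scoped MatrixGroups

open CongruenceSubgroup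

namespace Summit.BirchSwinnertonDyer.BirchSwinnertonDyer.Theorems.SignedMuAtTwo

/-! ## §1. Arithmetic input: a prime `q ≡ 5 (mod 8)` in a prescribed class divides `4^m + 1` -/

/-- **A prime `q ≡ 5 (mod 8)` divides `4^{(q−1)/4} + 1`** (`2` is a non-residue, Euler's criterion gives
`2^{(q−1)/2} ≡ −1 (mod q)`, and `(q−1)/2 = 2·((q−1)/4)`). [folklore] -/
theorem dvd_four_pow_add_one_of_mod_eight_eq_five {q : ℕ} (hq : q.Prime) (hq8 : q % 8 = 5) :
    (q : ℤ) ∣ 4 ^ (q / 4) + 1 := by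
  haveI : Fact q.Prime := ⟨hq⟩
  have hq2 : q ≠ 2 := by rintro rfl; norm_num at hq8
  have h2 : (2 : ZMod q) ≠ 0 := by
    intro h0
    have h0' : ((2 : ℕ) : ZMod q) = 0 := by exact_mod_cast h0
    exact hq2 ((Nat.prime_dvd_prime_iff_eq hq Nat.prime_two).mp ((ZMod.natCast_eq_zero_iff 2 q).mp h0'))
  have hns : ¬ IsSquare (2 : ZMod q) := by
    rw [ZMod.exists_sq_eq_two_iff hq2]; omega
  have hpow : (2 : ZMod q) ^ (q / 2) = -1 := by
    rcases ZMod.pow_div_two_eq_neg_one_or_one q h2 with h | h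
    · exact absurd ((ZMod.euler_criterion q h2).mpr h) hns
    · exact h
  have hq4 : q / 2 = 2 * (q / 4) := by omega
  have h4 : (4 : ZMod q) ^ (q / 4) = -1 := by
    rw [show (4 : ZMod q) = 2 ^ 2 by norm_num, ← pow_mul, ← hq4, hpow]
  rw [← ZMod.intCast_zmod_eq_zero_iff_dvd]
  push_cast
  rw [h4, neg_add_cancel]

/-- **Dirichlet.** For odd `N`, `b` coprime to `N` and any bound `B` there is a prime `q > B` with `q ≡ b (mod N)` and
`q ≡ 5 (mod 8)` (Mathlib `Nat.forall_exists_prime_gt_and_modEq` for the modulus `8N`). [folklore] -/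
theorem exists_prime_gt_modEq_and_mod_eight_eq_five {N : ℕ} (hN : Odd N) {b : ℕ} (hb : b.Coprime N) (B : ℕ) :
    ∃ q : ℕ, B < q ∧ q.Prime ∧ q ≡ b [MOD N] ∧ q % 8 = 5 := by
  have h8N : Nat.Coprime 8 N := by
    have h2 : Nat.Coprime 2 N := Nat.coprime_two_left.mpr hN
    simpa using h2.pow_left 3
  obtain ⟨x, hx8, hxN⟩ := Nat.chineseRemainder h8N 5 b
  have hxcop : x.Coprime (8 * N) := by
    apply Nat.Coprime.mul_right
    · show Nat.gcd x 8 = 1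
      rw [hx8.gcd_eq]; norm_num
    · show Nat.gcd x N = 1
      rw [hxN.gcd_eq]; exact hb
  obtain ⟨q, hqB, hqprime, hqmod⟩ :=
    Nat.forall_exists_prime_gt_and_modEq B (q := 8 * N) (Nat.mul_ne_zero (by norm_num) hN.pos.ne') hxcop
  refine ⟨q, hqB, hqprime, (hqmod.of_mul_left 8).trans hxN, ?_⟩
  have h8 : q ≡ 5 [MOD 8] := (hqmod.of_mul_right N).trans hx8
  exact h8

/-! ## §2. `E(u, 4^m/u)` at every odd level -/

section AnyLevel

variable {N : ℕ} {χ : Gamma0 N → ZMod 2}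

/-- **`E(u, 4^m/u)` at any odd level.** For every `b = −1` element `β` of `Γ₀(N)`, `N` odd, there is `m ≥ 1` such that
`χ β = χ β'` for every `b = −1` element `β'` with `d(β) d(β') ≡ 4^m (mod N)`: a prime `q ≡ 5 (mod 8)`, `q ≡ d(β) (mod N)` divides
`4^m + 1`, `m = (q−1)/4`, and the product `β₁ β₂` of `b = −1` elements with `d(β₁) = q`, `q d(β₂) = 4^m + κ₁ N` has lower-right
entry exactly `+4^m`. [cite: Pollack2003, Conj. 6.3] -/
theorem exists_chi_eq_of_b_neg_one_of_mul_d_eq_four_pow (hN : Odd N)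
    (hadd : ∀ γ δ : Gamma0 N, χ (γ * δ) = χ γ + χ δ)
    (hsmall : ∀ γ : Gamma0 N, ((γ : SL(2, ℤ)) 0 0 + (γ : SL(2, ℤ)) 1 1).natAbs ≤ 2 → χ γ = 0)
    (hkill : ∀ γ : Gamma0 N, (∃ k : ℕ, 1 ≤ k ∧ ((γ : SL(2, ℤ)) 1 1).natAbs = 4 ^ k) → χ γ = 0)
    {β : Gamma0 N} (hb : (β : SL(2, ℤ)) 0 1 = -1) :
    ∃ m : ℕ, 1 ≤ m ∧ ∀ β' : Gamma0 N, (β' : SL(2, ℤ)) 0 1 = -1 →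
      ((((β : SL(2, ℤ)) 1 1 : ℤ) : ZMod N)) * ((((β' : SL(2, ℤ)) 1 1 : ℤ) : ZMod N)) = 4 ^ m → χ β = χ β' := by
  haveI : NeZero N := ⟨hN.pos.ne'⟩
  set d : ℤ := (β : SL(2, ℤ)) 1 1 with hd
  have hdu : IsUnit ((d : ℤ) : ZMod N) := isUnit_gamma0_apply_one_one β
  set b : ℕ := ((d : ℤ) : ZMod N).val with hbdef
  have hbcop : b.Coprime N := by
    have h := ZMod.val_coe_unit_coprime hdu.unit
    rwa [IsUnit.unit_spec] at h
  obtain ⟨q, hqN, hqprime, hqb, hq8⟩ := exists_prime_gt_modEq_and_mod_eight_eq_five hN hbcop N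
  have hq5 : 5 ≤ q := by
    have := hqprime.two_le
    omega
  set m : ℕ := q / 4 with hm
  have hm1 : 1 ≤ m := by omega
  obtain ⟨m₀, hm₀⟩ := dvd_four_pow_add_one_of_mod_eight_eq_five hqprime hq8
  -- `q` is prime to `N`; Bezout and the element `β₁ = (α₁, −1; Nκ₁, q)`
  have hqcop : Nat.Coprime q N := by
    show Nat.gcd q N = 1
    rw [hqb.gcd_eq]; exact hbcop
  obtain ⟨α₁, κ₁, h1⟩ : IsCoprime (q : ℤ) (N : ℤ) := Nat.isCoprime_iff_coprime.mpr hqcop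
  obtain ⟨β₁, -, h101, h110, h111⟩ := ThetaLayerLambdaCongruenceAtTwo.exists_gamma0_entries (N := N)
    α₁ (-1) (N * κ₁) q (by linear_combination h1) (dvd_mul_right _ _)
  -- `δ₂ := m₀ − α₁`: `q δ₂ = 4^m + κ₁ N` is prime to `N`; the element `β₂ = (α₂, −1; Nκ₂, δ₂)`
  set δ₂ : ℤ := m₀ - α₁ with hδ₂
  have hqδ : (q : ℤ) * δ₂ = 4 ^ m + κ₁ * N := by
    rw [hδ₂]; linear_combination -hm₀ - h1
  have hcop4 : IsCoprime ((4 : ℤ) ^ m) N := by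
    apply IsCoprime.pow_left
    rw [show (4 : ℤ) = ((4 : ℕ) : ℤ) by norm_num, Nat.isCoprime_iff_coprime]
    simpa using (Nat.coprime_two_left.mpr hN).pow_left 2
  have hcopδ : IsCoprime δ₂ (N : ℤ) := by
    have e1 : IsCoprime ((q : ℤ) * δ₂) N := by
      rw [hqδ]; exact hcop4.add_mul_right_left κ₁
    exact e1.of_mul_left_right
  obtain ⟨α₂, κ₂, h2⟩ := hcopδ
  obtain ⟨β₂, -, h201, -, h211⟩ := ThetaLayerLambdaCongruenceAtTwo.exists_gamma0_entries (N := N)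
    α₂ (-1) (N * κ₂) δ₂ (by linear_combination h2) (dvd_mul_right _ _)
  -- the product has lower-right entry `+4^m`, so `χ β₁ = χ β₂`
  have hprod : ((β₁ * β₂ : Gamma0 N) : SL(2, ℤ)) 1 1 = 4 ^ m := by
    rw [gamma0_mul_apply_one_one', h110, h201, h111, h211]; linear_combination hqδ
  have hkilled : χ (β₁ * β₂) = 0 :=
    hkill _ ⟨m, hm1, by rw [hprod, Int.natAbs_pow]; rfl⟩
  have h12 : χ β₁ = χ β₂ := by
    rw [hadd] at hkilled
    have e1 : χ β₁ = -χ β₂ := by linear_combination hkilled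
    rw [e1, ZMod.neg_eq_self_mod_two]
  -- residues: `d(β₁) ≡ d(β)` and `d(β) d(β₂) ≡ 4^m`
  have hqb' : (q : ZMod N) = (b : ZMod N) := (ZMod.natCast_eq_natCast_iff _ _ _).mpr hqb
  have hres1 : ((((β₁ : SL(2, ℤ)) 1 1 : ℤ) : ZMod N)) = ((d : ℤ) : ZMod N) := by
    rw [h111, Int.cast_natCast, hqb', hbdef, ZMod.natCast_zmod_val]
  have hres2 : ((d : ℤ) : ZMod N) * (((δ₂ : ℤ) : ZMod N)) = 4 ^ m := by
    rw [← hres1, h111]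
    have e1 := congrArg (Int.cast : ℤ → ZMod N) hqδ
    push_cast at e1 ⊢
    rw [e1, ZMod.natCast_self, mul_zero, add_zero]
  refine ⟨m, hm1, fun β' hb' h ↦ ?_⟩
  have hres3 : ((((β' : SL(2, ℤ)) 1 1 : ℤ) : ZMod N)) = ((((β₂ : SL(2, ℤ)) 1 1 : ℤ) : ZMod N)) := by
    rw [h211]
    exact hdu.mul_left_cancel (h.trans hres2.symm)
  rw [chi_eq_of_apply_zero_one_eq_neg_one hadd hsmall hb h101 hres1.symm, h12,
    ← chi_eq_of_apply_zero_one_eq_neg_one hadd hsmall hb' h201 hres3]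

/-! ## §3. `F(−u) = F(u)` and `F(1/u) = F(u)` at any odd level, GIVEN 4-invariance -/

/-- Iterated 4-invariance: if `E(4u, u)` holds for every unit `u` then `E(4^j u, u)`. [folklore] -/
theorem chi_eq_of_b_neg_one_of_d_eq_four_pow_mul_of_four [NeZero N]
    (hadd : ∀ γ δ : Gamma0 N, χ (γ * δ) = χ γ + χ δ)
    (hsmall : ∀ γ : Gamma0 N, ((γ : SL(2, ℤ)) 0 0 + (γ : SL(2, ℤ)) 1 1).natAbs ≤ 2 → χ γ = 0)
    (hfour : ∀ β β' : Gamma0 N, (β : SL(2, ℤ)) 0 1 = -1 → (β' : SL(2, ℤ)) 0 1 = -1 →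
      ((((β : SL(2, ℤ)) 1 1 : ℤ) : ZMod N)) = 4 * ((((β' : SL(2, ℤ)) 1 1 : ℤ) : ZMod N)) → χ β = χ β')
    (j : ℕ) {β β' : Gamma0 N} (hb : (β : SL(2, ℤ)) 0 1 = -1) (hb' : (β' : SL(2, ℤ)) 0 1 = -1)
    (h : ((((β : SL(2, ℤ)) 1 1 : ℤ) : ZMod N)) = 4 ^ j * ((((β' : SL(2, ℤ)) 1 1 : ℤ) : ZMod N))) :
    χ β = χ β' := by
  induction j generalizing β with
  | zero =>
    rw [pow_zero, one_mul] at h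
    exact chi_eq_of_apply_zero_one_eq_neg_one hadd hsmall hb hb' h
  | succ j ih =>
    -- an intermediate `b = −1` element with `d ≡ 4^j d(β')`
    have hu' := isUnit_gamma0_apply_one_one β'
    have h4u : IsUnit ((4 : ZMod N) ^ j * ((((β' : SL(2, ℤ)) 1 1 : ℤ) : ZMod N))) := by
      refine IsUnit.mul (IsUnit.pow _ ?_) hu'
      -- `4 ^ j d(β')` divides... : `4` is a unit since `d(β) = 4^(j+1) d(β')` is a unit
      have hu := isUnit_gamma0_apply_one_one β
      rw [h, pow_succ] at hu
      exact isUnit_of_mul_isUnit_right (isUnit_of_mul_isUnit_left hu)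
    obtain ⟨β₁, hb1, hd1⟩ := exists_b_neg_one_of_isUnit (N := N) h4u
    have e : ((((β : SL(2, ℤ)) 1 1 : ℤ) : ZMod N)) = 4 * ((((β₁ : SL(2, ℤ)) 1 1 : ℤ) : ZMod N)) := by
      rw [hd1, h, pow_succ]; ring
    rw [hfour β β₁ hb hb1 e]
    exact ih hb1 hd1

/-- **`F(−u) = F(u)` at any odd level, given 4-invariance.** For `b = −1` elements with `d(β) ≡ −d(β') (mod N)`:
`χ β = χ β'` — `u ∼ 4^m/u` (§2) `∼ −u/4^m` (`S`-companion) `∼ −u` (4-invariance `m` times). [cite: Pollack2003, Conj. 6.3] -/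
theorem chi_eq_of_b_neg_one_of_d_eq_neg_of_four (hN : Odd N)
    (hadd : ∀ γ δ : Gamma0 N, χ (γ * δ) = χ γ + χ δ)
    (hsmall : ∀ γ : Gamma0 N, ((γ : SL(2, ℤ)) 0 0 + (γ : SL(2, ℤ)) 1 1).natAbs ≤ 2 → χ γ = 0)
    (hkill : ∀ γ : Gamma0 N, (∃ k : ℕ, 1 ≤ k ∧ ((γ : SL(2, ℤ)) 1 1).natAbs = 4 ^ k) → χ γ = 0)
    (hfour : ∀ β β' : Gamma0 N, (β : SL(2, ℤ)) 0 1 = -1 → (β' : SL(2, ℤ)) 0 1 = -1 →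
      ((((β : SL(2, ℤ)) 1 1 : ℤ) : ZMod N)) = 4 * ((((β' : SL(2, ℤ)) 1 1 : ℤ) : ZMod N)) → χ β = χ β')
    {β β' : Gamma0 N} (hb : (β : SL(2, ℤ)) 0 1 = -1) (hb' : (β' : SL(2, ℤ)) 0 1 = -1)
    (h : ((((β : SL(2, ℤ)) 1 1 : ℤ) : ZMod N)) = -((((β' : SL(2, ℤ)) 1 1 : ℤ) : ZMod N))) :
    χ β = χ β' := by
  haveI : NeZero N := ⟨hN.pos.ne'⟩
  obtain ⟨m, -, hE⟩ := exists_chi_eq_of_b_neg_one_of_mul_d_eq_four_pow hN hadd hsmall hkill hb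
  have hdu := isUnit_gamma0_apply_one_one β
  set U : (ZMod N)ˣ := hdu.unit with hU
  have hUval : (U : ZMod N) = ((((β : SL(2, ℤ)) 1 1 : ℤ) : ZMod N)) := hdu.unit_spec
  have h4cop : Nat.Coprime 4 N := by simpa using (Nat.coprime_two_left.mpr hN).pow_left 2
  set W : (ZMod N)ˣ := ZMod.unitOfCoprime 4 h4cop with hW
  have hWval : (W : ZMod N) = 4 := by rw [hW, ZMod.coe_unitOfCoprime]; norm_num
  -- `β₁` with `d(β₁) ≡ 4^m / d(β)`
  obtain ⟨β₁, hb1, hd1⟩ := exists_b_neg_one_of_isUnit (N := N) (W ^ m * U⁻¹).isUnit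
  have e1 : ((((β : SL(2, ℤ)) 1 1 : ℤ) : ZMod N)) * ((((β₁ : SL(2, ℤ)) 1 1 : ℤ) : ZMod N)) = 4 ^ m := by
    rw [hd1, ← hUval, Units.val_mul, Units.val_pow_eq_pow_val, hWval]
    linear_combination ((4 : ZMod N) ^ m) * Units.mul_inv U
  have h01 : χ β = χ β₁ := hE β₁ hb1 e1
  -- `β₂` with `d(β₂) ≡ −d(β) / 4^m`, so `d(β₁) d(β₂) ≡ −1`
  obtain ⟨β₂, hb2, hd2⟩ := exists_b_neg_one_of_isUnit (N := N) (-(U * (W ^ m)⁻¹)).isUnit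
  have e2 : ((((β₁ : SL(2, ℤ)) 1 1 : ℤ) : ZMod N)) * ((((β₂ : SL(2, ℤ)) 1 1 : ℤ) : ZMod N)) = -1 := by
    rw [hd1, hd2, Units.val_neg, Units.val_mul, Units.val_mul]
    linear_combination (-1 : ZMod N) * ((U⁻¹ : (ZMod N)ˣ) : ZMod N) * (U : ZMod N) * Units.mul_inv (W ^ m)
      - Units.inv_mul U
  have h12 : χ β₁ = χ β₂ := chi_eq_of_b_neg_one_of_mul_d_eq_neg_one hadd hsmall hb1 hb2 e2
  -- `d(β') ≡ −d(β) = 4^m d(β₂)`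
  have e3 : ((((β' : SL(2, ℤ)) 1 1 : ℤ) : ZMod N)) = 4 ^ m * ((((β₂ : SL(2, ℤ)) 1 1 : ℤ) : ZMod N)) := by
    have e : ((((β' : SL(2, ℤ)) 1 1 : ℤ) : ZMod N)) = -(U : ZMod N) := by rw [hUval, h, neg_neg]
    rw [e, hd2, Units.val_neg, Units.val_mul, ← hWval, ← Units.val_pow_eq_pow_val]
    linear_combination (U : ZMod N) * Units.mul_inv (W ^ m)
  have h32 : χ β' = χ β₂ := chi_eq_of_b_neg_one_of_d_eq_four_pow_mul_of_four hadd hsmall hfour m hb' hb2 e3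
  rw [h01, h12, h32]

/-- **`F(1/u) = F(u)` at any odd level, given 4-invariance** (`1/u = −(−1/u)`: Theorem 3 and the `S`-companion).
[cite: Pollack2003, Conj. 6.3] -/
theorem chi_eq_of_b_neg_one_of_mul_d_eq_one_of_four (hN : Odd N)
    (hadd : ∀ γ δ : Gamma0 N, χ (γ * δ) = χ γ + χ δ)
    (hsmall : ∀ γ : Gamma0 N, ((γ : SL(2, ℤ)) 0 0 + (γ : SL(2, ℤ)) 1 1).natAbs ≤ 2 → χ γ = 0)
    (hkill : ∀ γ : Gamma0 N, (∃ k : ℕ, 1 ≤ k ∧ ((γ : SL(2, ℤ)) 1 1).natAbs = 4 ^ k) → χ γ = 0)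
    (hfour : ∀ β β' : Gamma0 N, (β : SL(2, ℤ)) 0 1 = -1 → (β' : SL(2, ℤ)) 0 1 = -1 →
      ((((β : SL(2, ℤ)) 1 1 : ℤ) : ZMod N)) = 4 * ((((β' : SL(2, ℤ)) 1 1 : ℤ) : ZMod N)) → χ β = χ β')
    {β β' : Gamma0 N} (hb : (β : SL(2, ℤ)) 0 1 = -1) (hb' : (β' : SL(2, ℤ)) 0 1 = -1)
    (h : ((((β : SL(2, ℤ)) 1 1 : ℤ) : ZMod N)) * ((((β' : SL(2, ℤ)) 1 1 : ℤ) : ZMod N)) = 1) :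
    χ β = χ β' := by
  haveI : NeZero N := ⟨hN.pos.ne'⟩
  obtain ⟨β₂, hb2, hd2⟩ := exists_b_neg_one_of_isUnit (N := N) (isUnit_gamma0_apply_one_one β').neg
  have e1 : ((((β : SL(2, ℤ)) 1 1 : ℤ) : ZMod N)) * ((((β₂ : SL(2, ℤ)) 1 1 : ℤ) : ZMod N)) = -1 := by
    rw [hd2, mul_neg, h]
  have e2 : ((((β' : SL(2, ℤ)) 1 1 : ℤ) : ZMod N)) = -((((β₂ : SL(2, ℤ)) 1 1 : ℤ) : ZMod N)) := by
    rw [hd2, neg_neg]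
  rw [chi_eq_of_b_neg_one_of_mul_d_eq_neg_one hadd hsmall hb hb2 e1]
  exact (chi_eq_of_b_neg_one_of_d_eq_neg_of_four hN hadd hsmall hkill hfour hb' hb2 e2).symm

end AnyLevel

/-! ## §4. Odd prime level: unconditional `F(−u) = F(u)`, `F(1/u) = F(u)` and their `K/E` forms -/

section PrimeLevel

variable {p : ℕ} [Fact p.Prime] {χ : Gamma0 p → ZMod 2}

/-- **`F(−u) = F(u)` at every odd prime level.** For `b = −1` elements of `Γ₀(p)` with `d(β) ≡ −d(β') (mod p)`: `χ β = χ β'`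
(Theorem 3 with the lead's 4-invariance `chi_eq_of_b_neg_one_of_d_eq_four_mul`). [cite: Pollack2003, Conj. 6.3] -/
theorem chi_eq_of_b_neg_one_of_d_eq_neg (hp2 : p ≠ 2)
    (hadd : ∀ γ δ : Gamma0 p, χ (γ * δ) = χ γ + χ δ)
    (hsmall : ∀ γ : Gamma0 p, ((γ : SL(2, ℤ)) 0 0 + (γ : SL(2, ℤ)) 1 1).natAbs ≤ 2 → χ γ = 0)
    (hkill : ∀ γ : Gamma0 p, (∃ k : ℕ, 1 ≤ k ∧ ((γ : SL(2, ℤ)) 1 1).natAbs = 4 ^ k) → χ γ = 0)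
    {β β' : Gamma0 p} (hb : (β : SL(2, ℤ)) 0 1 = -1) (hb' : (β' : SL(2, ℤ)) 0 1 = -1)
    (h : ((((β : SL(2, ℤ)) 1 1 : ℤ) : ZMod p)) = -((((β' : SL(2, ℤ)) 1 1 : ℤ) : ZMod p))) :
    χ β = χ β' :=
  chi_eq_of_b_neg_one_of_d_eq_neg_of_four ((Fact.out : p.Prime).odd_of_ne_two hp2) hadd hsmall hkill
    (fun _ _ hb₁ hb₂ e ↦ chi_eq_of_b_neg_one_of_d_eq_four_mul hp2 hadd hsmall hkill hb₁ hb₂ e) hb hb' h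

/-- **`F(1/u) = F(u)` at every odd prime level.** For `b = −1` elements of `Γ₀(p)` with `d(β) d(β') ≡ 1 (mod p)`: `χ β = χ β'`.
[cite: Pollack2003, Conj. 6.3] -/
theorem chi_eq_of_b_neg_one_of_mul_d_eq_one (hp2 : p ≠ 2)
    (hadd : ∀ γ δ : Gamma0 p, χ (γ * δ) = χ γ + χ δ)
    (hsmall : ∀ γ : Gamma0 p, ((γ : SL(2, ℤ)) 0 0 + (γ : SL(2, ℤ)) 1 1).natAbs ≤ 2 → χ γ = 0)
    (hkill : ∀ γ : Gamma0 p, (∃ k : ℕ, 1 ≤ k ∧ ((γ : SL(2, ℤ)) 1 1).natAbs = 4 ^ k) → χ γ = 0)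
    {β β' : Gamma0 p} (hb : (β : SL(2, ℤ)) 0 1 = -1) (hb' : (β' : SL(2, ℤ)) 0 1 = -1)
    (h : ((((β : SL(2, ℤ)) 1 1 : ℤ) : ZMod p)) * ((((β' : SL(2, ℤ)) 1 1 : ℤ) : ZMod p)) = 1) :
    χ β = χ β' :=
  chi_eq_of_b_neg_one_of_mul_d_eq_one_of_four ((Fact.out : p.Prime).odd_of_ne_two hp2) hadd hsmall hkill
    (fun _ _ hb₁ hb₂ e ↦ chi_eq_of_b_neg_one_of_d_eq_four_mul hp2 hadd hsmall hkill hb₁ hb₂ e) hb hb' h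

/-- `E(r, s)` from `r = −s` (odd prime level). [cite: Pollack2003, Conj. 6.3] -/
theorem E_of_eq_neg (hp2 : p ≠ 2) (hadd : ∀ γ δ : Gamma0 p, χ (γ * δ) = χ γ + χ δ)
    (hsmall : ∀ γ : Gamma0 p, ((γ : SL(2, ℤ)) 0 0 + (γ : SL(2, ℤ)) 1 1).natAbs ≤ 2 → χ γ = 0)
    (hkill : ∀ γ : Gamma0 p, (∃ k : ℕ, 1 ≤ k ∧ ((γ : SL(2, ℤ)) 1 1).natAbs = 4 ^ k) → χ γ = 0)
    (r s : ZMod p) (h : r = -s) :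
    ∀ β β' : Gamma0 p, (β : SL(2, ℤ)) 0 1 = -1 → (β' : SL(2, ℤ)) 0 1 = -1 →
      ((((β : SL(2, ℤ)) 1 1 : ℤ) : ZMod p)) = r → ((((β' : SL(2, ℤ)) 1 1 : ℤ) : ZMod p)) = s → χ β = χ β' :=
  fun _ _ hb hb' hd hd' ↦ chi_eq_of_b_neg_one_of_d_eq_neg hp2 hadd hsmall hkill hb hb' (by rw [hd, hd', h])

/-- `E(r, s)` from `r s = 1` (odd prime level). [cite: Pollack2003, Conj. 6.3] -/
theorem E_of_mul_eq_one (hp2 : p ≠ 2) (hadd : ∀ γ δ : Gamma0 p, χ (γ * δ) = χ γ + χ δ)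
    (hsmall : ∀ γ : Gamma0 p, ((γ : SL(2, ℤ)) 0 0 + (γ : SL(2, ℤ)) 1 1).natAbs ≤ 2 → χ γ = 0)
    (hkill : ∀ γ : Gamma0 p, (∃ k : ℕ, 1 ≤ k ∧ ((γ : SL(2, ℤ)) 1 1).natAbs = 4 ^ k) → χ γ = 0)
    (r s : ZMod p) (h : r * s = 1) :
    ∀ β β' : Gamma0 p, (β : SL(2, ℤ)) 0 1 = -1 → (β' : SL(2, ℤ)) 0 1 = -1 →
      ((((β : SL(2, ℤ)) 1 1 : ℤ) : ZMod p)) = r → ((((β' : SL(2, ℤ)) 1 1 : ℤ) : ZMod p)) = s → χ β = χ β' :=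
  fun _ _ hb hb' hd hd' ↦ chi_eq_of_b_neg_one_of_mul_d_eq_one hp2 hadd hsmall hkill hb hb' (by rw [hd, hd', h])

/-- `K(−r)` from `K(r)` (odd prime level): if `χ` kills the `b = −1` elements with `d ≡ r` it kills those with `d ≡ −r`.
[cite: Pollack2003, Conj. 6.3] -/
theorem K_of_K_neg (hp2 : p ≠ 2) (hadd : ∀ γ δ : Gamma0 p, χ (γ * δ) = χ γ + χ δ)
    (hsmall : ∀ γ : Gamma0 p, ((γ : SL(2, ℤ)) 0 0 + (γ : SL(2, ℤ)) 1 1).natAbs ≤ 2 → χ γ = 0)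
    (hkill : ∀ γ : Gamma0 p, (∃ k : ℕ, 1 ≤ k ∧ ((γ : SL(2, ℤ)) 1 1).natAbs = 4 ^ k) → χ γ = 0)
    (r : ZMod p) (hr : r ≠ 0)
    (hK : ∀ β : Gamma0 p, (β : SL(2, ℤ)) 0 1 = -1 → ((((β : SL(2, ℤ)) 1 1 : ℤ) : ZMod p)) = r → χ β = 0) :
    ∀ β : Gamma0 p, (β : SL(2, ℤ)) 0 1 = -1 → ((((β : SL(2, ℤ)) 1 1 : ℤ) : ZMod p)) = -r → χ β = 0 := by
  intro β hb hd
  obtain ⟨β₁, hb1, hd1⟩ := exists_b_neg_one_of_isUnit (N := p) (isUnit_iff_ne_zero.mpr hr)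
  rw [chi_eq_of_b_neg_one_of_d_eq_neg hp2 hadd hsmall hkill hb hb1 (by rw [hd, hd1]), hK β₁ hb1 hd1]

/-- `K(1/r)` from `K(r)` (odd prime level). [cite: Pollack2003, Conj. 6.3] -/
theorem K_of_K_inv (hp2 : p ≠ 2) (hadd : ∀ γ δ : Gamma0 p, χ (γ * δ) = χ γ + χ δ)
    (hsmall : ∀ γ : Gamma0 p, ((γ : SL(2, ℤ)) 0 0 + (γ : SL(2, ℤ)) 1 1).natAbs ≤ 2 → χ γ = 0)
    (hkill : ∀ γ : Gamma0 p, (∃ k : ℕ, 1 ≤ k ∧ ((γ : SL(2, ℤ)) 1 1).natAbs = 4 ^ k) → χ γ = 0)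
    (r : ZMod p) (hr : r ≠ 0)
    (hK : ∀ β : Gamma0 p, (β : SL(2, ℤ)) 0 1 = -1 → ((((β : SL(2, ℤ)) 1 1 : ℤ) : ZMod p)) = r → χ β = 0) :
    ∀ β : Gamma0 p, (β : SL(2, ℤ)) 0 1 = -1 → ((((β : SL(2, ℤ)) 1 1 : ℤ) : ZMod p)) = r⁻¹ → χ β = 0 := by
  intro β hb hd
  obtain ⟨β₁, hb1, hd1⟩ := exists_b_neg_one_of_isUnit (N := p) (isUnit_iff_ne_zero.mpr hr)
  rw [chi_eq_of_b_neg_one_of_mul_d_eq_one hp2 hadd hsmall hkill hb hb1 (by rw [hd, hd1, inv_mul_cancel₀ hr]),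
    hK β₁ hb1 hd1]

end PrimeLevel

end Summit.BirchSwinnertonDyer.BirchSwinnertonDyer.Theorems.SignedMuAtTwo
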